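import Summits.ResolutionOfSingularities.KangarooAtlas.MizutaniLemma29Converse
import Summits.ResolutionOfSingularities.KangarooAtlas.MizutaniLemma29Field
import Summits.ResolutionOfSingularities.KangarooAtlas.MizutaniTowerDerivation
import HarnessLib

/-!
# Mizutani's Lemma 2.9 (2) — the intrinsic normal form and the cases that need no base change

Cell topic `Summits/ResolutionOfSingularities/KangarooAtlas` (pub-rosobs); namespace
`Summit.ResolutionOfSingularities.KangarooAtlas.Mizutani`.  Part of the Lean transcription of Mizutani 1973 §2
around the in-house note MIZUTANI-PROOF-g59 (AI-written, AI-audited; *AI review is weaker than expert review*; not a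
resolution theorem).

Setting of Lemma 2.9 (p. 92–94) in tower form: `h : IsRootTower L K p x a` a two-generator root tower of exponent
`p ≠ 2` (`[K : L] = p²`), `D : K → K` an `L`-linear differential operator of order `≤ 2` with `D 1 = D a₀ = D a₁ = 0`
(Mizutani's `t₁, t₂ ∈ T = ker D`).  Writing `∂_i = D^{(e_i)}`:

* `IsRootTower.eq_three_of_isDiffOpLE_two` — the INTRINSIC normal form
  `D = D(a₀²)·D^{(2,0)} + D(a₀a₁)·D^{(1,1)} + D(a₁²)·D^{(0,2)}` (Mizutani's «`D = a'D₁² + b'D₁D₂ + c'D₂²`», p. 93, with the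
  coefficients identified as values of `D`);
* `IsRootTower.pow_mem_range` — `y^p ∈ L` for every `y ∈ K`; `IsRootTower.swap` — the tower on `(a₁, a₀)`;
* **case `D(a₁²) = D(a₀a₁) = 0`** (`D = α·D^{(2,0)}`): `IsRootTower.exists_normalForm_of_apply_eq_zero` — then
  `D = (α/2)·(∂₀ ∘ ∂₀)` with `∂₀ a₁ = 0`, `∂₀ a₀ = 1`: Mizutani's conclusion holds with `(c₁, c₂) = (a₁, a₀)`;
* the COMPLETED SQUARE (`γ = D(a₁²) ≠ 0`, `β' = D(a₀a₁)/γ`, `D' = β'∂₀ + ∂₁`, `w = D'(β')`):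
  `IsRootTower.eq_smul_comp_sub_smul` — if `D(a₀²)·γ = D(a₀a₁)²` (degenerate symbol) then
  `D = (γ/2)·(D' ∘ D') − (γ w/2)·∂₀`;
* **case degenerate symbol and `w = 0`**: `IsRootTower.exists_normalForm_of_sq_of_eq_zero` — if moreover
  `dim_L ker D = 2p` then `D = (γ/2)·(D' ∘ D')` with `D' c₁ = 0`, `D' a₁ = 1` for a `p`-basis `(c₁, a₁)` of `K/L`
  (`c₁ ∈ ker D' ∖ L` exists because `dim ker(D'∘D') ≤ 2·dim ker D'`).

The two remaining cases (non-degenerate symbol; degenerate symbol with `w ≠ 0`) have `dim ker D < 2p` and are treated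
by base change to `K ⊗_L K` in the sequel files.

References: [Mizutani1973HironakaGroupSchemes] Lemma 2.9, p. 92–94.
-/

open MvPolynomial Literature.AlgebraicGeometry.Resolution
open scoped IntermediateField

namespace Summit.ResolutionOfSingularities.KangarooAtlas.Mizutani

universe u

section Cases

variable {L K : Type u} [Field L] [Field K] [Algebra L K] {p : ℕ} [hp : Fact p.Prime] [CharP K p]
  {x : Fin 2 → L} {a : Fin 2 → K}

/-! ### Small combinatorics of exponents over `Fin 2` -/

/-- Exponents of degree `≤ 2` lie in the box when `p ≠ 2`. [folklore] -/
theorem inBox_of_degree_le_two (hp2 : p ≠ 2) {N : Fin 2 →₀ ℕ} (hN : N.degree ≤ 2) : InBox (p ^ 1) N := by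
  intro i
  have h3 : 3 ≤ p := by
    have := hp.out.two_le
    omega
  have := Finsupp.le_degree i N
  rw [pow_one]; omega

omit hp [CharP K p] in
/-- `a^{2e_i} = a_i²`. [folklore] -/
theorem prod_pow_single_two (i : Fin 2) : (∏ k, a k ^ (Finsupp.single i 2 : Fin 2 →₀ ℕ) k) = a i ^ 2 := by
  fin_cases i <;> simp [Finsupp.single_apply]

omit hp [CharP K p] in
/-- `a^{e₀+e₁} = a₀a₁`. [folklore] -/
theorem prod_pow_single_add_single :
    (∏ k, a k ^ (Finsupp.single 0 1 + Finsupp.single 1 1 : Fin 2 →₀ ℕ) k) = a 0 * a 1 := by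
  simp [Finsupp.single_apply]

omit hp in
/-- Degrees of the three exponents of degree `2`. [folklore] -/
theorem degree_single_add_single : (Finsupp.single 0 1 + Finsupp.single 1 1 : Fin 2 →₀ ℕ).degree = 2 := by
  rw [map_add, Finsupp.degree_single, Finsupp.degree_single]

/-- `D^{(W)}`, `|W| = 2`, on the monomials of degree `≤ 2`: `D^{(W)} a^N = δ_{N,W}`. [cite: EGAIV4, Thm. 16.11.2 (16.11.2.1)] -/
theorem IsRootTower.hsD_prod_pow_of_degree_two (h : IsRootTower L K (p ^ 1) x a) (hp2 : p ≠ 2) {W N : Fin 2 →₀ ℕ}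
    (hW : W.degree = 2) (hN : N.degree ≤ 2) :
    h.hsD W (∏ i, a i ^ N i) = if N = W then 1 else 0 := by
  classical
  have hNb := inBox_of_degree_le_two hp2 hN
  by_cases hNW : N = W
  · subst hNW
    rw [if_pos rfl, h.hsD_prod_pow' N N hNb, mchoose_self, Nat.cast_one, one_mul]
    exact Finset.prod_eq_one fun j _ => by rw [Nat.sub_self, pow_zero]
  · rw [if_neg hNW, h.hsD_prod_pow' W N hNb, mchoose_eq_zero_of_not_le, Nat.cast_zero, zero_mul]
    intro hle
    have h1 := degree_le_of_le hle
    have hne : W ≠ N := fun h' => hNW h'.symm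
    have h2 := degree_lt_of_lt hle hne
    omega

/-! ### The intrinsic normal form -/

/-- **Intrinsic normal form of an order-2 operator killing `1, a₀, a₁`**:
`D = D(a₀²)·D^{(2,0)} + D(a₀a₁)·D^{(1,1)} + D(a₁²)·D^{(0,2)}` (an operator of order `≤ 2` is determined by its values
on the monomials of degree `≤ 2`). [cite: Mizutani1973HironakaGroupSchemes, Lemma 2.9 (proof, p. 93: «D = a'D₁² + b'D₁D₂ + c'D₂²»)] -/
theorem IsRootTower.eq_three_of_isDiffOpLE_two (h : IsRootTower L K (p ^ 1) x a) (hp2 : p ≠ 2) {D : K →ₗ[L] K}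
    (hD : IsDiffOpLE L 2 D) (h1 : D 1 = 0) (ha : ∀ i, D (a i) = 0) :
    D = D (a 0 ^ 2) • h.hsD (Finsupp.single 0 2) + D (a 0 * a 1) • h.hsD (Finsupp.single 0 1 + Finsupp.single 1 1) +
      D (a 1 ^ 2) • h.hsD (Finsupp.single 1 2) := by
  classical
  have hW20 : (Finsupp.single 0 2 : Fin 2 →₀ ℕ).degree = 2 := Finsupp.degree_single _ _
  have hW02 : (Finsupp.single 1 2 : Fin 2 →₀ ℕ).degree = 2 := Finsupp.degree_single _ _
  have hW11 := degree_single_add_single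
  have hord : IsDiffOpLE L 2 (D - (D (a 0 ^ 2) • h.hsD (Finsupp.single 0 2) +
      D (a 0 * a 1) • h.hsD (Finsupp.single 0 1 + Finsupp.single 1 1) + D (a 1 ^ 2) • h.hsD (Finsupp.single 1 2))) := by
    refine hD.sub (IsDiffOpLE.add (IsDiffOpLE.add ?_ ?_) ?_)
    · exact (h.isDiffOpLE_hsD 2 (inBox_of_degree_le_two hp2 hW20.le) hW20.le).smul _
    · exact (h.isDiffOpLE_hsD 2 (inBox_of_degree_le_two hp2 hW11.le) hW11.le).smul _
    · exact (h.isDiffOpLE_hsD 2 (inBox_of_degree_le_two hp2 hW02.le) hW02.le).smul _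
  have key := h.eq_zero_of_isDiffOpLE_of_forall 2 _ hord fun N hN => by
    simp only [LinearMap.sub_apply, LinearMap.add_apply, LinearMap.smul_apply, smul_eq_mul]
    rw [h.hsD_prod_pow_of_degree_two hp2 hW20 hN, h.hsD_prod_pow_of_degree_two hp2 hW11 hN,
      h.hsD_prod_pow_of_degree_two hp2 hW02 hN]
    rcases Nat.lt_or_ge N.degree 2 with hlt | hge
    · -- degree ≤ 1: everything vanishes
      have hD0 : D (∏ i, a i ^ N i) = 0 := by
        rcases eq_zero_or_exists_single_of_degree_le_one (by omega : N.degree ≤ 1) with h0 | ⟨l, hl⟩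
        · rw [h0]; simpa using h1
        · rw [hl, prod_pow_single_eq]; exact ha l
      have hne1 : N ≠ Finsupp.single 0 2 := fun h' => by rw [h', hW20] at hlt; omega
      have hne2 : N ≠ Finsupp.single 0 1 + Finsupp.single 1 1 := fun h' => by rw [h', hW11] at hlt; omega
      have hne3 : N ≠ Finsupp.single 1 2 := fun h' => by rw [h', hW02] at hlt; omega
      rw [hD0, if_neg hne1, if_neg hne2, if_neg hne3]; ring
    · have hdeg : N.degree = 2 := le_antisymm hN hge
      have hd1 : (Finsupp.single 0 2 : Fin 2 →₀ ℕ) ≠ Finsupp.single 0 1 + Finsupp.single 1 1 := by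
        intro h'; have := congrArg (fun M : Fin 2 →₀ ℕ => M 1) h'; simp at this
      have hd2 : (Finsupp.single 0 2 : Fin 2 →₀ ℕ) ≠ Finsupp.single 1 2 := by
        intro h'; have := congrArg (fun M : Fin 2 →₀ ℕ => M 1) h'; simp at this
      have hd3 : (Finsupp.single 0 1 + Finsupp.single 1 1 : Fin 2 →₀ ℕ) ≠ Finsupp.single 1 2 := by
        intro h'; have := congrArg (fun M : Fin 2 →₀ ℕ => M 0) h'; simp at this
      -- the three exponents of degree `2` (cf. `RoyWaldschmidt1997.finsupp_fin_two_of_degree_two`)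
      have hcases : N = Finsupp.single 0 2 ∨ N = Finsupp.single 0 1 + Finsupp.single 1 1 ∨ N = Finsupp.single 1 2 := by
        rw [Literature.RingTheory.MvPolynomial.Ruppert.degree_fin_two] at hdeg
        have hc : N 0 = 2 ∧ N 1 = 0 ∨ N 0 = 1 ∧ N 1 = 1 ∨ N 0 = 0 ∧ N 1 = 2 := by omega
        rcases hc with ⟨h0, h1'⟩ | ⟨h0, h1'⟩ | ⟨h0, h1'⟩
        · left; ext i; fin_cases i <;> simp [h0, h1']
        · right; left; ext i; fin_cases i <;> simp [h0, h1']
        · right; right; ext i; fin_cases i <;> simp [h0, h1']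
      rcases hcases with hN' | hN' | hN' <;> subst hN'
      · rw [if_pos rfl, if_neg hd1, if_neg hd2, prod_pow_single_two]; ring
      · rw [if_neg hd1.symm, if_pos rfl, if_neg hd3, prod_pow_single_add_single]; ring
      · rw [if_neg hd2.symm, if_neg hd3.symm, if_pos rfl, prod_pow_single_two]; ring
  exact (sub_eq_zero.mp key)

/-! ### `y^p ∈ L`, and the swapped tower -/

/-- **Every element of a root tower of exponent `p` has its `p`-th power in the ground field** (Frobenius is additive and
`a_i^p = x_i ∈ L`). [cite: Mizutani1973HironakaGroupSchemes, Lemma 2.9 (statement: «k ⊃ K ⊃ k^p»)] -/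
theorem IsRootTower.pow_mem_range (h : IsRootTower L K (p ^ 1) x a) (y : K) :
    y ^ p ∈ Set.range (algebraMap L K) := by
  have hy := h.mem_span y
  refine Submodule.span_induction ?_ ?_ ?_ ?_ hy
  · rintro _ ⟨N, -, rfl⟩
    refine ⟨∏ i, x i ^ N i, ?_⟩
    rw [map_prod, ← Finset.prod_pow]
    refine Finset.prod_congr rfl fun i _ => ?_
    rw [map_pow, ← pow_one p, ← h.pow_eq i, pow_one, ← pow_mul, ← pow_mul, mul_comm]
  · exact ⟨0, by rw [map_zero, zero_pow hp.out.ne_zero]⟩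
  · rintro y z - - ⟨l, hl⟩ ⟨m, hm⟩
    exact ⟨l + m, by rw [map_add, hl, hm, add_pow_char]⟩
  · rintro l y - ⟨m, hm⟩
    exact ⟨l ^ p * m, by rw [map_mul, map_pow, hm, Algebra.smul_def, mul_pow]⟩

/-- **The tower on the swapped `p`-basis `(a₁, a₀)`.** [folklore] -/
theorem IsRootTower.swap (h : IsRootTower L K (p ^ 1) x a) : IsRootTower L K (p ^ 1) ![x 1, x 0] ![a 1, a 0] := by
  haveI := h.finiteDimensional
  refine isRootTower_of_adjoin_eq_top (pow_pos hp.out.pos 1) ?_ ?_ (by rw [h.finrank_eq])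
  · intro i; fin_cases i
    · exact h.pow_eq 1
    · exact h.pow_eq 0
  · have hr : Set.range (![a 1, a 0] : Fin 2 → K) = Set.range a := by
      ext y
      simp only [Set.mem_range]
      constructor
      · rintro ⟨i, rfl⟩; fin_cases i; exacts [⟨1, rfl⟩, ⟨0, rfl⟩]
      · rintro ⟨i, rfl⟩; fin_cases i; exacts [⟨1, rfl⟩, ⟨0, rfl⟩]
    rw [hr, h.adjoin_range_eq_top]

/-! ### Case `D(a₁²) = D(a₀a₁) = 0`: `D = α · D^{(2,0)} = (α/2)·∂₀²` -/

/-- **Case (i) of Lemma 2.9 (2), ⇒**: if `D(a₁²) = D(a₀a₁) = 0` then `D = u·(D₀ ∘ D₀)` for the derivation `D₀ = ∂₀`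
(`D₀ a₁ = 0`, `D₀ a₀ = 1`) and `u = D(a₀²)/2` — Mizutani's conclusion with the `p`-basis `(c₁, c₂) = (a₁, a₀)`.
[cite: Mizutani1973HironakaGroupSchemes, Lemma 2.9 (2), p. 93–94 («If a = 0, then D = D₁²»)] -/
theorem IsRootTower.exists_normalForm_of_apply_eq_zero (h : IsRootTower L K (p ^ 1) x a) (hp2 : p ≠ 2) {D : K →ₗ[L] K}
    (hD : IsDiffOpLE L 2 D) (h1 : D 1 = 0) (ha : ∀ i, D (a i) = 0) (hγ : D (a 1 ^ 2) = 0) (hβ : D (a 0 * a 1) = 0) :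
    ∃ (x' : Fin 2 → L) (c : Fin 2 → K) (_ : IsRootTower L K (p ^ 1) x' c) (D₀ : Derivation L K K) (u : K),
      D₀ (c 0) = 0 ∧ D₀ (c 1) = 1 ∧ D = u • ((D₀ : K →ₗ[L] K) ∘ₗ (D₀ : K →ₗ[L] K)) := by
  refine ⟨![x 1, x 0], ![a 1, a 0], h.swap, h.hsDer le_rfl 0, D (a 0 ^ 2) / 2, ?_, ?_, ?_⟩
  · show h.hsDer le_rfl 0 (a 1) = 0
    rw [h.hsDer_gen]; simp
  · show h.hsDer le_rfl 0 (a 0) = 1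
    rw [h.hsDer_gen]; simp
  · rw [h.hsDer_coe, h.hsD_single_one_comp_self, smul_smul, div_mul_cancel₀ _ (two_ne_zero_of_ne_two hp2)]
    conv_lhs => rw [h.eq_three_of_isDiffOpLE_two hp2 hD h1 ha, hγ, hβ, zero_smul, zero_smul, add_zero, add_zero]

/-! ### The completed square -/

/-- A derivation followed by a scaled operator: `δ ∘ (c·Φ) = (δ c)·Φ + c·(δ ∘ Φ)`. [folklore] -/
theorem derivation_comp_smul (δ : Derivation L K K) (c : K) (Φ : K →ₗ[L] K) :
    (δ : K →ₗ[L] K) ∘ₗ (c • Φ) = δ c • Φ + c • ((δ : K →ₗ[L] K) ∘ₗ Φ) := by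
  ext y
  simp only [LinearMap.comp_apply, LinearMap.smul_apply, LinearMap.add_apply, smul_eq_mul, Derivation.coeFn_coe,
    Derivation.leibniz]
  ring

/-- `∂₀ ∘ ∂₁ = D^{(1,1)} = ∂₁ ∘ ∂₀`. [cite: EGAIV4, Thm. 16.11.2 (16.11.2.2)] -/
theorem IsRootTower.hsD_single_comp_single (h : IsRootTower L K (p ^ 1) x a) (i j : Fin 2) (hij : i ≠ j) :
    h.hsD (Finsupp.single i 1) ∘ₗ h.hsD (Finsupp.single j 1) = h.hsD (Finsupp.single i 1 + Finsupp.single j 1) := by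
  classical
  rw [h.hsD_comp]
  have hm : mchoose (Finsupp.single i 1 + Finsupp.single j 1 : Fin 2 →₀ ℕ) (Finsupp.single j 1) = 1 := by
    rw [mchoose_eq_prod]
    refine Finset.prod_eq_one fun k _ => ?_
    simp only [Finsupp.add_apply, Finsupp.single_apply]
    by_cases hik : i = k <;> by_cases hjk : j = k <;> simp [hik, hjk]
    exact absurd (hik.trans hjk.symm) hij
  rw [hm, Nat.cast_one, one_smul]

/-- **The completed square.**  With `α = D(a₀²)`, `β = D(a₀a₁)`, `γ = D(a₁²) ≠ 0`, `β' = β/γ`, `D' = β'∂₀ + ∂₁` and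
`w = D'(β') = β'∂₀β' + ∂₁β'`: if the symbol is a square (`αγ = β²`) then `D = (γ/2)·(D' ∘ D') − (γw/2)·∂₀`.
[cite: Mizutani1973HironakaGroupSchemes, Lemma 2.9 (2) (proof, p. 94: «(a² − 4b) = 0, hence b = (a/2)²; thus D = (D₁ + ½aD₂)² − …D₂»)] -/
theorem IsRootTower.eq_smul_comp_sub_smul (h : IsRootTower L K (p ^ 1) x a) (hp2 : p ≠ 2) {D : K →ₗ[L] K}
    (hD : IsDiffOpLE L 2 D) (h1 : D 1 = 0) (ha : ∀ i, D (a i) = 0) (hγ : D (a 1 ^ 2) ≠ 0)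
    (hsq : D (a 0 ^ 2) * D (a 1 ^ 2) = D (a 0 * a 1) ^ 2) :
    let β' : K := D (a 0 * a 1) / D (a 1 ^ 2)
    let D' : K →ₗ[L] K := β' • h.hsD (Finsupp.single 0 1) + h.hsD (Finsupp.single 1 1)
    D = (D (a 1 ^ 2) / 2) • (D' ∘ₗ D') -
      (D (a 1 ^ 2) * (β' * h.hsD (Finsupp.single 0 1) β' + h.hsD (Finsupp.single 1 1) β') / 2) •
        h.hsD (Finsupp.single 0 1) := by
  intro β' D'
  have h2 : (2 : K) ≠ 0 := two_ne_zero_of_ne_two hp2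
  set α := D (a 0 ^ 2) with hα
  set β := D (a 0 * a 1) with hβ
  set γ := D (a 1 ^ 2) with hγ'
  set d0 := h.hsD (Finsupp.single 0 1) with hd0
  set d1 := h.hsD (Finsupp.single 1 1) with hd1
  -- expand `D' ∘ D'`
  have hc00 : d0 ∘ₗ d0 = (2 : K) • h.hsD (Finsupp.single 0 2) := h.hsD_single_one_comp_self 0
  have hc11 : d1 ∘ₗ d1 = (2 : K) • h.hsD (Finsupp.single 1 2) := h.hsD_single_one_comp_self 1
  have hc01 : d0 ∘ₗ d1 = h.hsD (Finsupp.single 0 1 + Finsupp.single 1 1) := h.hsD_single_comp_single 0 1 (by decide)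
  have hc10 : d1 ∘ₗ d0 = h.hsD (Finsupp.single 0 1 + Finsupp.single 1 1) := by
    rw [h.hsD_single_comp_single 1 0 (by decide), add_comm]
  have hL0 : d0 ∘ₗ (β' • d0) = d0 β' • d0 + β' • (d0 ∘ₗ d0) := derivation_comp_smul (h.hsDer le_rfl 0) β' d0
  have hL1 : d1 ∘ₗ (β' • d0) = d1 β' • d0 + β' • (d1 ∘ₗ d0) := derivation_comp_smul (h.hsDer le_rfl 1) β' d0
  have hexp : D' ∘ₗ D' = (β' * d0 β' + d1 β') • d0 + (2 * β' ^ 2) • h.hsD (Finsupp.single 0 2) +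
      (2 * β') • h.hsD (Finsupp.single 0 1 + Finsupp.single 1 1) + (2 : K) • h.hsD (Finsupp.single 1 2) := by
    show (β' • d0 + d1) ∘ₗ (β' • d0 + d1) = _
    rw [LinearMap.add_comp, LinearMap.comp_add, LinearMap.comp_add, LinearMap.smul_comp, LinearMap.smul_comp, hL0, hL1,
      hc00, hc11, hc01, hc10]
    ext y
    simp only [LinearMap.add_apply, LinearMap.smul_apply, smul_eq_mul]
    ring
  -- compare with the normal form
  have hαeq : α = γ * β' ^ 2 := by
    show α = γ * (β / γ) ^ 2
    rw [div_pow, ← hsq]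
    field_simp
  have hβeq : β = γ * β' := by
    show β = γ * (β / γ)
    field_simp
  conv_lhs => rw [h.eq_three_of_isDiffOpLE_two hp2 hD h1 ha]
  rw [hexp, ← hα, ← hβ, ← hγ', hαeq, hβeq]
  ext y
  simp only [LinearMap.add_apply, LinearMap.sub_apply, LinearMap.smul_apply, smul_eq_mul]
  field_simp
  ring

/-! ### Case degenerate symbol, `w = 0`: `D = (γ/2)·D'²` and the `p`-basis `(c₁, a₁)` -/

/-- `dim ker(Φ ∘ Φ) ≤ 2 · dim ker Φ`. [folklore] -/
theorem finrank_ker_comp_self_le [FiniteDimensional L K] (Φ : K →ₗ[L] K) :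
    Module.finrank L (LinearMap.ker (Φ ∘ₗ Φ)) ≤ 2 * Module.finrank L (LinearMap.ker Φ) := by
  set V := LinearMap.ker (Φ ∘ₗ Φ) with hV
  set ψ : V →ₗ[L] K := Φ.domRestrict V with hψ
  have hrn := LinearMap.finrank_range_add_finrank_ker ψ
  have hrange : LinearMap.range ψ ≤ LinearMap.ker Φ := by
    rintro _ ⟨v, rfl⟩
    have hv2 : Φ (Φ (v : K)) = 0 := v.2
    exact hv2
  have hker : Module.finrank L (LinearMap.ker ψ) ≤ Module.finrank L (LinearMap.ker Φ) := by
    -- `ker ψ` embeds into `ker Φ` by the subtype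
    let ι : LinearMap.ker ψ →ₗ[L] LinearMap.ker Φ :=
      { toFun := fun v => ⟨(v.1 : K), by
          have hv : Φ (v.1 : K) = 0 := v.2
          exact hv⟩
        map_add' := fun v w => rfl
        map_smul' := fun c v => rfl }
    have hinj : Function.Injective ι := by
      intro v w hvw
      apply Subtype.ext; apply Subtype.ext
      exact congrArg (fun z : LinearMap.ker Φ => (z : K)) hvw
    exact LinearMap.finrank_le_finrank_of_injective hinj
  have h1 := Submodule.finrank_mono hrange
  omega

/-- **Case (iv) of Lemma 2.9 (2), ⇒**: degenerate symbol (`αγ = β²`, `γ ≠ 0`), `w = D'(β') = 0`, and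
`dim_L ker D = 2p`.  Then `D = (γ/2)·(D' ∘ D')` for the DERIVATION `D' = β'∂₀ + ∂₁`, and there is a `p`-basis
`(c₁, c₂) = (c₁, a₁)` of `K/L` with `D' c₁ = 0`, `D' a₁ = 1` (`c₁ ∈ ker D' ∖ L` exists since
`2p = dim ker(D'∘D') ≤ 2 dim ker D'`).  [cite: Mizutani1973HironakaGroupSchemes, Lemma 2.9 (2) (proof, p. 94: «if D₁(a) + ½aD₂(a) = 0 then D = (D₁ + ½aD₂)²»; «dim ker(D₀) = p … thus we can find c₁, c₂»)] -/
theorem IsRootTower.exists_normalForm_of_sq_of_eq_zero (h : IsRootTower L K (p ^ 1) x a) (hp2 : p ≠ 2)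
    {D : K →ₗ[L] K} (hD : IsDiffOpLE L 2 D) (h1 : D 1 = 0) (ha : ∀ i, D (a i) = 0) (hγ : D (a 1 ^ 2) ≠ 0)
    (hsq : D (a 0 ^ 2) * D (a 1 ^ 2) = D (a 0 * a 1) ^ 2)
    (hw : (D (a 0 * a 1) / D (a 1 ^ 2)) * h.hsD (Finsupp.single 0 1) (D (a 0 * a 1) / D (a 1 ^ 2)) +
      h.hsD (Finsupp.single 1 1) (D (a 0 * a 1) / D (a 1 ^ 2)) = 0)
    (hdim : Module.finrank L (LinearMap.ker D) = 2 * p) :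
    ∃ (x' : Fin 2 → L) (c : Fin 2 → K) (_ : IsRootTower L K (p ^ 1) x' c) (D₀ : Derivation L K K) (u : K),
      D₀ (c 0) = 0 ∧ D₀ (c 1) = 1 ∧ D = u • ((D₀ : K →ₗ[L] K) ∘ₗ (D₀ : K →ₗ[L] K)) := by
  classical
  haveI := h.finiteDimensional
  have h2 : (2 : K) ≠ 0 := two_ne_zero_of_ne_two hp2
  set β' : K := D (a 0 * a 1) / D (a 1 ^ 2) with hβ'
  set D₀ : Derivation L K K := β' • h.hsDer le_rfl 0 + h.hsDer le_rfl 1 with hD₀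
  have hD₀coe : (D₀ : K →ₗ[L] K) = β' • h.hsD (Finsupp.single 0 1) + h.hsD (Finsupp.single 1 1) := rfl
  -- `D = (γ/2) · D₀ ∘ D₀`
  have hDeq : D = (D (a 1 ^ 2) / 2) • ((D₀ : K →ₗ[L] K) ∘ₗ (D₀ : K →ₗ[L] K)) := by
    have key := h.eq_smul_comp_sub_smul hp2 hD h1 ha hγ hsq
    simp only at key
    rw [hw, mul_zero, zero_div, zero_smul, sub_zero] at key
    rw [hD₀coe]
    exact key
  -- `D₀ a₁ = 1`
  have hD₀a1 : D₀ (a 1) = 1 := by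
    show β' • h.hsDer le_rfl 0 (a 1) + h.hsDer le_rfl 1 (a 1) = 1
    rw [h.hsDer_gen, h.hsDer_gen]; simp
  -- `dim ker D₀ ≥ p`, so `ker D₀ ⊄ L`
  have hu : D (a 1 ^ 2) / 2 ≠ 0 := div_ne_zero hγ h2
  have hkerD : LinearMap.ker D = LinearMap.ker ((D₀ : K →ₗ[L] K) ∘ₗ (D₀ : K →ₗ[L] K)) := by
    rw [hDeq]
    ext y
    simp only [LinearMap.mem_ker, LinearMap.smul_apply, smul_eq_mul, mul_eq_zero, hu, false_or]
  have hge : p ≤ Module.finrank L (LinearMap.ker (D₀ : K →ₗ[L] K)) := by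
    have := finrank_ker_comp_self_le (D₀ : K →ₗ[L] K)
    rw [← hkerD, hdim] at this
    omega
  have hnot : ¬ ((LinearMap.ker (D₀ : K →ₗ[L] K) : Set K) ⊆ ((⊥ : IntermediateField L K) : Set K)) := by
    intro hsub
    have hle : LinearMap.ker (D₀ : K →ₗ[L] K) ≤ (⊥ : IntermediateField L K).toSubalgebra.toSubmodule :=
      fun y hy => hsub hy
    have h1' := Submodule.finrank_mono hle
    have hbot : Module.finrank L (⊥ : IntermediateField L K).toSubalgebra.toSubmodule = 1 := by
      change Module.finrank L (⊥ : IntermediateField L K) = 1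
      exact IntermediateField.finrank_bot
    rw [hbot] at h1'
    have := hp.out.two_le
    omega
  obtain ⟨c₁, hc₁K, hc₁⟩ := Set.not_subset.mp hnot
  have hc₁' : c₁ ∉ (⊥ : IntermediateField L K) := hc₁
  have hD₀c₁ : D₀ c₁ = 0 := LinearMap.mem_ker.mp hc₁K
  -- `a₁ ∉ L(c₁)` since `D₀` kills `L(c₁)` and `D₀ a₁ = 1`
  have ha1 : a 1 ∉ L⟮c₁⟯ := by
    intro hmem
    have halg : ∀ z ∈ ({c₁} : Set K), IsAlgebraic L z := fun z _ => Algebra.IsAlgebraic.isAlgebraic z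
    have hmem' : a 1 ∈ Algebra.adjoin L ({c₁} : Set K) := by
      rw [← IntermediateField.adjoin_simple_toSubalgebra_of_isAlgebraic (Algebra.IsAlgebraic.isAlgebraic c₁)]
      exact hmem
    have hEq : Set.EqOn D₀ (0 : Derivation L K K) ({c₁} : Set K) := by
      intro z hz
      rw [Set.mem_singleton_iff.mp hz, hD₀c₁]; rfl
    have h0 := Derivation.eqOn_adjoin hEq hmem'
    rw [hD₀a1] at h0
    exact one_ne_zero h0
  -- the tower on `(c₁, a₁)`
  obtain ⟨l₁, hl₁⟩ := h.pow_mem_range c₁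
  set t : Fin 2 → K := ![c₁, a 1] with ht
  set x' : Fin 2 → L := ![l₁, x 1] with hx'
  have hxt : ∀ i, t i ^ p = algebraMap L K (x' i) := by
    intro i; fin_cases i
    · exact hl₁.symm
    · show a 1 ^ p = algebraMap L K (x 1)
      rw [← pow_one p, ← h.pow_eq 1, pow_one]
  have hdimK : Module.finrank L K = p ^ 2 := by rw [h.finrank_eq, pow_one]
  have htower : IsRootTower L K (p ^ 1) x' t :=
    isRootTower_pair hdimK hxt (by simpa [ht] using hc₁') (by simpa [ht] using ha1)
  refine ⟨x', t, htower, D₀, D (a 1 ^ 2) / 2, ?_, ?_, hDeq⟩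
  · simpa [ht] using hD₀c₁
  · simpa [ht] using hD₀a1

end Cases

end Summit.ResolutionOfSingularities.KangarooAtlas.Mizutani
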